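import Mathlib
import HarnessLib
import Summits.Ventures.LatticeQCDFlow.Exactness.IMHLevelDecomposition
import Summits.Ventures.LatticeQCDFlow.Scaling.AutoregressiveGaugeHeatBathColdExact

/-!
# LatticeQCDFlow / Scaling — the exact one-plaquette heat bath AWAY FROM THE COLD CONFIGURATION: its acceptance at
# `U` is EXACTLY `(Z/(c^{#B}F_R(U)))·π{F_R ≤ F_R(U)} + q{F_R > F_R(U)}`; more ordered proposals are always accepted,
# less ordered regions are entered at the target's rate

HONEST FRAMING: exact (Metropolis-corrected) sampling algorithms for lattice gauge theory;
figures of merit are autocorrelation/cost numbers at stated couplings and volumes; no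
continuum-physics claim.

Venture `LatticeQCDFlow` (cell pub-lqcd), topic `Scaling`, FANOUT row 30 (lean-1, GEN-31) — OUR WORK, the gauge instance
of `Exactness/IMHLevelDecomposition` (this generation).  Setting: `L ≥ 2`; `w` continuous, `0 < m ≤ w ≤ M = w(1)`;
`(B, t, rank)` ranked, `k = #Bᶜ`; target `π = (F/Z)·Haar^{⊗E}`, block proposal `q = (F_B/Z_B)·Haar^{⊗E}`, exact sampler
`K = indepMH q (Z_B F_R/Z)` whose importance weight is the UNCOVERED WEIGHT `F_R(U) = ∏_{p ∉ B} w(U_p)` up to the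
constant `Z_B/Z = c^{#B}/Z`.  GEN-26/28 bracketed the acceptance at `U` (`Z/(c^{#B}M^k) ≤ A(U) ≤ Z/(c^{#B}F_R(U))`,
`AutoregressiveGaugeColdStickiest`); here it is computed EXACTLY, and so is the one-step law from every configuration:

* **`heatBath_acceptMass_profile`** — `A(U) = (Z/(c^{#B}F_R(U)))·π{V : F_R(V) ≤ F_R(U)} + q{V : F_R(V) > F_R(U)}`: the
  target mass of the configurations AT MOST AS ORDERED as `U` on the uncovered plaquettes, at the importance ratio of
  `U`, plus the model mass of the MORE ORDERED ones (the two one-term truncations are GEN-28's squeeze; at the cold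
  configuration the second term vanishes and the first is `Z/(c^{#B}M^k)`).
* **`heatBath_apply_of_more_ordered`** — a proposal more ordered than the current state is ALWAYS accepted:
  `K(U, S) = q(S)` for every measurable `S ⊆ {F_R > F_R(U)}`.
* **`heatBath_apply_of_less_ordered`** — into configurations at most as ordered the chain moves at the target's rate:
  `K(U, S) = (Z/(c^{#B}F_R(U)))·π(S)` for every measurable `S ⊆ {F_R ≤ F_R(U)}` with `U ∉ S`.

NOT CLAIMED: multi-step laws from a non-cold start (the level `F_R(U_n)` moves with the chain); the distribution of
`F_R` under `π` or `q` (the two distribution functions in the profile are not evaluated).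
No `def`, no `sorry`, nothing cited as a fact beyond the tree.
-/

noncomputable section

namespace Summit.Ventures.LatticeQCDFlow.Theory2.Autoregressive

open MeasureTheory ProbabilityTheory Function Finset
open scoped ENNReal
open Literature.MathematicalPhysics.QuantumFieldTheory Literature.MathematicalPhysics.QuantumLattice
open Summit.Ventures.LatticeQCDFlow.Exactness Summit.Ventures.LatticeQCDFlow.Scoring

variable {d L : ℕ} [NeZero L] {G : Type*} [Group G] [TopologicalSpace G] [IsTopologicalGroup G]
  [CompactSpace G] [SecondCountableTopology G] [MeasurableSpace G] [BorelSpace G]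

/-- **THE EXACT ACCEPTANCE PROFILE OF THE EXACT HEAT BATH**: at every configuration `U`,
`A(U) = (Z/(c^{#B}F_R(U)))·π{F_R ≤ F_R(U)} + q{F_R > F_R(U)}`. [ours] -/
theorem heatBath_acceptMass_profile (hL : 2 ≤ L) {w : G → ℝ} (hw : Continuous w) {m M : ℝ} (hm0 : 0 < m)
    (hm : ∀ g, m ≤ w g) (hM : ∀ g, w g ≤ M) (hw1 : w 1 = M)
    (B : Finset (Plaquette d L)) (t : Plaquette d L → Edge d L)
    (ht : ∀ p ∈ B, t p ∈ ({(p.1, p.2.1.1), (p.1.shift p.2.1.1, p.2.1.2),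
        (p.1.shift p.2.1.2, p.2.1.1), (p.1, p.2.1.2)} : Finset (Edge d L)))
    (rank : Plaquette d L → ℕ)
    (hrank : ∀ p ∈ B, ∀ p' ∈ B, p ≠ p' → t p ∈ ({(p'.1, p'.2.1.1), (p'.1.shift p'.2.1.1, p'.2.1.2),
        (p'.1.shift p'.2.1.2, p'.2.1.1), (p'.1, p'.2.1.2)} : Finset (Edge d L)) → rank p < rank p')
    (π q : Measure (GaugeConfig d L G)) [IsProbabilityMeasure π] [IsProbabilityMeasure q]
    (hπ : π = (Measure.pi fun _ : Edge d L => haarProbability G).withDensity fun U =>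
      ENNReal.ofReal ((∏ p : Plaquette d L, w (plaquetteHolonomy U p.1 p.2.1.1 p.2.1.2)) /
        ∫ V, ∏ p : Plaquette d L, w (plaquetteHolonomy V p.1 p.2.1.1 p.2.1.2)
          ∂(Measure.pi fun _ : Edge d L => haarProbability G)))
    (hq : q = (Measure.pi fun _ : Edge d L => haarProbability G).withDensity fun U =>
      ENNReal.ofReal ((∏ p ∈ B, w (plaquetteHolonomy U p.1 p.2.1.1 p.2.1.2)) /
        ∫ V, ∏ p ∈ B, w (plaquetteHolonomy V p.1 p.2.1.1 p.2.1.2)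
          ∂(Measure.pi fun _ : Edge d L => haarProbability G))) (U : GaugeConfig d L G) :
    (imhAcceptMass q (fun U =>
        ((∫ V, ∏ p : Plaquette d L, w (plaquetteHolonomy V p.1 p.2.1.1 p.2.1.2)
            ∂(Measure.pi fun _ : Edge d L => haarProbability G)) /
          ((∫ V, ∏ p ∈ B, w (plaquetteHolonomy V p.1 p.2.1.1 p.2.1.2)
            ∂(Measure.pi fun _ : Edge d L => haarProbability G)) *
            ∏ p ∈ Finset.univ \ B, w (plaquetteHolonomy U p.1 p.2.1.1 p.2.1.2)))⁻¹) U).toReal =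
      (∫ V, ∏ p : Plaquette d L, w (plaquetteHolonomy V p.1 p.2.1.1 p.2.1.2)
          ∂(Measure.pi fun _ : Edge d L => haarProbability G)) /
        ((∫ g, w g ∂(haarProbability G)) ^ B.card * ∏ p ∈ Finset.univ \ B, w (plaquetteHolonomy U p.1 p.2.1.1 p.2.1.2)) *
          π.real {V | ∏ p ∈ Finset.univ \ B, w (plaquetteHolonomy V p.1 p.2.1.1 p.2.1.2) ≤ ∏ p ∈ Finset.univ \ B, w (plaquetteHolonomy U p.1 p.2.1.1 p.2.1.2)} +
        q.real {V | ∏ p ∈ Finset.univ \ B, w (plaquetteHolonomy U p.1 p.2.1.1 p.2.1.2) < ∏ p ∈ Finset.univ \ B, w (plaquetteHolonomy V p.1 p.2.1.1 p.2.1.2)} := by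
  obtain ⟨-, hρq, -, hρm, hρpos⟩ := heatBath_cold_acceptMass_eq hL hw hm0 hm hM hw1 B t ht rank hrank π q hπ hq
  have hw0 : ∀ g, 0 < w g := fun g => hm0.trans_le (hm g)
  have hc : 0 < ∫ g, w g ∂(haarProbability G) := haarProbability_integral_pos_of_continuous_pos hw hw0
  have hFRpos : ∀ V : GaugeConfig d L G, 0 < ∏ p ∈ Finset.univ \ B, w (plaquetteHolonomy V p.1 p.2.1.1 p.2.1.2) :=
    fun V => prod_pos fun p _ => hw0 _
  have hZB : (∫ V, ∏ p ∈ B, w (plaquetteHolonomy V p.1 p.2.1.1 p.2.1.2)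
      ∂(Measure.pi fun _ : Edge d L => haarProbability G)) = (∫ g, w g ∂(haarProbability G)) ^ B.card :=
    integral_prod_weight_eq_pow_of_rank (G := G) hL hw hm0 hm hM B t ht rank hrank
  have hZBpos : 0 < (∫ V, ∏ p ∈ B, w (plaquetteHolonomy V p.1 p.2.1.1 p.2.1.2)
      ∂(Measure.pi fun _ : Edge d L => haarProbability G)) := by
    rw [hZB]; exact pow_pos hc _
  have hZTpos : 0 < (∫ V, ∏ p : Plaquette d L, w (plaquetteHolonomy V p.1 p.2.1.1 p.2.1.2)
      ∂(Measure.pi fun _ : Edge d L => haarProbability G)) :=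
    (div_pos_iff_of_pos_right (mul_pos hZBpos (hFRpos U))).1 (hρpos U)
  set ρ : GaugeConfig d L G → ℝ := fun U => (∫ V, ∏ p : Plaquette d L, w (plaquetteHolonomy V p.1 p.2.1.1 p.2.1.2)
            ∂(Measure.pi fun _ : Edge d L => haarProbability G)) /
          ((∫ V, ∏ p ∈ B, w (plaquetteHolonomy V p.1 p.2.1.1 p.2.1.2)
            ∂(Measure.pi fun _ : Edge d L => haarProbability G)) *
            ∏ p ∈ Finset.univ \ B, w (plaquetteHolonomy U p.1 p.2.1.1 p.2.1.2)) with hρ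
  have hwm : Measurable fun U => (ρ U)⁻¹ := hρm.inv
  have hw0' : ∀ U, 0 < (ρ U)⁻¹ := fun U => inv_pos.2 (hρpos U)
  have hρpos' : ∀ V, 0 < ρ V := fun V => hρpos V
  have hπ' : (q.withDensity fun U => ENNReal.ofReal (ρ U)⁻¹) = π := withDensity_inv_density hρm hρpos hρq
  haveI : IsProbabilityMeasure (q.withDensity fun U => ENNReal.ofReal (ρ U)⁻¹) := by rw [hπ']; infer_instance
  -- the level sets of the kernel weight `ρ⁻¹ = Z_B F_R / Z` are the level sets of the uncovered weight `F_R`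
  have hiff_le : ∀ V : GaugeConfig d L G, (ρ V)⁻¹ ≤ (ρ U)⁻¹ ↔ ∏ p ∈ Finset.univ \ B, w (plaquetteHolonomy V p.1 p.2.1.1 p.2.1.2) ≤ ∏ p ∈ Finset.univ \ B, w (plaquetteHolonomy U p.1 p.2.1.1 p.2.1.2) := by
    intro V
    rw [inv_le_inv₀ (hρpos' V) (hρpos' U), hρ]
    show (∫ V, ∏ p : Plaquette d L, w (plaquetteHolonomy V p.1 p.2.1.1 p.2.1.2)
      ∂(Measure.pi fun _ : Edge d L => haarProbability G)) / ((∫ V, ∏ p ∈ B, w (plaquetteHolonomy V p.1 p.2.1.1 p.2.1.2)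
      ∂(Measure.pi fun _ : Edge d L => haarProbability G)) * ∏ p ∈ Finset.univ \ B, w (plaquetteHolonomy U p.1 p.2.1.1 p.2.1.2)) ≤
      (∫ V, ∏ p : Plaquette d L, w (plaquetteHolonomy V p.1 p.2.1.1 p.2.1.2)
      ∂(Measure.pi fun _ : Edge d L => haarProbability G)) / ((∫ V, ∏ p ∈ B, w (plaquetteHolonomy V p.1 p.2.1.1 p.2.1.2)
      ∂(Measure.pi fun _ : Edge d L => haarProbability G)) * ∏ p ∈ Finset.univ \ B, w (plaquetteHolonomy V p.1 p.2.1.1 p.2.1.2)) ↔ _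
    rw [div_le_div_iff_of_pos_left hZTpos (mul_pos hZBpos (hFRpos U)) (mul_pos hZBpos (hFRpos V))]
    exact ⟨fun h => le_of_mul_le_mul_left h hZBpos, fun h => mul_le_mul_of_nonneg_left h hZBpos.le⟩
  have hiff_lt : ∀ V : GaugeConfig d L G, (ρ U)⁻¹ < (ρ V)⁻¹ ↔ ∏ p ∈ Finset.univ \ B, w (plaquetteHolonomy U p.1 p.2.1.1 p.2.1.2) < ∏ p ∈ Finset.univ \ B, w (plaquetteHolonomy V p.1 p.2.1.1 p.2.1.2) := by
    intro V
    rw [← not_le, hiff_le V, not_le]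
  have hlev_le : {V : GaugeConfig d L G | (ρ V)⁻¹ ≤ (ρ U)⁻¹} = {V | ∏ p ∈ Finset.univ \ B, w (plaquetteHolonomy V p.1 p.2.1.1 p.2.1.2) ≤ ∏ p ∈ Finset.univ \ B, w (plaquetteHolonomy U p.1 p.2.1.1 p.2.1.2)} :=
    Set.ext fun V => hiff_le V
  have hlev_lt : {V : GaugeConfig d L G | (ρ U)⁻¹ < (ρ V)⁻¹} = {V | ∏ p ∈ Finset.univ \ B, w (plaquetteHolonomy U p.1 p.2.1.1 p.2.1.2) < ∏ p ∈ Finset.univ \ B, w (plaquetteHolonomy V p.1 p.2.1.1 p.2.1.2)} :=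
    Set.ext fun V => hiff_lt V
  have hval : ((ρ U)⁻¹)⁻¹ = (∫ V, ∏ p : Plaquette d L, w (plaquetteHolonomy V p.1 p.2.1.1 p.2.1.2)
          ∂(Measure.pi fun _ : Edge d L => haarProbability G)) /
        ((∫ g, w g ∂(haarProbability G)) ^ B.card * ∏ p ∈ Finset.univ \ B, w (plaquetteHolonomy U p.1 p.2.1.1 p.2.1.2)) := by
    rw [inv_inv, hρ]
    show (∫ V, ∏ p : Plaquette d L, w (plaquetteHolonomy V p.1 p.2.1.1 p.2.1.2)
      ∂(Measure.pi fun _ : Edge d L => haarProbability G)) / ((∫ V, ∏ p ∈ B, w (plaquetteHolonomy V p.1 p.2.1.1 p.2.1.2)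
      ∂(Measure.pi fun _ : Edge d L => haarProbability G)) * ∏ p ∈ Finset.univ \ B, w (plaquetteHolonomy U p.1 p.2.1.1 p.2.1.2)) = _
    rw [hZB]
  have h := imhAcceptMass_toReal_level (q := q) hwm hw0' U
  rw [hπ', hlev_le, hlev_lt, hval] at h
  exact h

/-- **A MORE ORDERED PROPOSAL IS ALWAYS ACCEPTED**: `K(U, S) = q(S)` for every measurable `S ⊆ {F_R > F_R(U)}`. [ours] -/
theorem heatBath_apply_of_more_ordered (hL : 2 ≤ L) {w : G → ℝ} (hw : Continuous w) {m M : ℝ} (hm0 : 0 < m)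
    (hm : ∀ g, m ≤ w g) (hM : ∀ g, w g ≤ M) (hw1 : w 1 = M)
    (B : Finset (Plaquette d L)) (t : Plaquette d L → Edge d L)
    (ht : ∀ p ∈ B, t p ∈ ({(p.1, p.2.1.1), (p.1.shift p.2.1.1, p.2.1.2),
        (p.1.shift p.2.1.2, p.2.1.1), (p.1, p.2.1.2)} : Finset (Edge d L)))
    (rank : Plaquette d L → ℕ)
    (hrank : ∀ p ∈ B, ∀ p' ∈ B, p ≠ p' → t p ∈ ({(p'.1, p'.2.1.1), (p'.1.shift p'.2.1.1, p'.2.1.2),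
        (p'.1.shift p'.2.1.2, p'.2.1.1), (p'.1, p'.2.1.2)} : Finset (Edge d L)) → rank p < rank p')
    (π q : Measure (GaugeConfig d L G)) [IsProbabilityMeasure π] [IsProbabilityMeasure q]
    (hπ : π = (Measure.pi fun _ : Edge d L => haarProbability G).withDensity fun U =>
      ENNReal.ofReal ((∏ p : Plaquette d L, w (plaquetteHolonomy U p.1 p.2.1.1 p.2.1.2)) /
        ∫ V, ∏ p : Plaquette d L, w (plaquetteHolonomy V p.1 p.2.1.1 p.2.1.2)
          ∂(Measure.pi fun _ : Edge d L => haarProbability G)))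
    (hq : q = (Measure.pi fun _ : Edge d L => haarProbability G).withDensity fun U =>
      ENNReal.ofReal ((∏ p ∈ B, w (plaquetteHolonomy U p.1 p.2.1.1 p.2.1.2)) /
        ∫ V, ∏ p ∈ B, w (plaquetteHolonomy V p.1 p.2.1.1 p.2.1.2)
          ∂(Measure.pi fun _ : Edge d L => haarProbability G))) (U : GaugeConfig d L G)
    {S : Set (GaugeConfig d L G)} (hS : MeasurableSet S)
    (hsub : S ⊆ {V | ∏ p ∈ Finset.univ \ B, w (plaquetteHolonomy U p.1 p.2.1.1 p.2.1.2) < ∏ p ∈ Finset.univ \ B, w (plaquetteHolonomy V p.1 p.2.1.1 p.2.1.2)}) :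
    indepMH q (fun U =>
        ((∫ V, ∏ p : Plaquette d L, w (plaquetteHolonomy V p.1 p.2.1.1 p.2.1.2)
            ∂(Measure.pi fun _ : Edge d L => haarProbability G)) /
          ((∫ V, ∏ p ∈ B, w (plaquetteHolonomy V p.1 p.2.1.1 p.2.1.2)
            ∂(Measure.pi fun _ : Edge d L => haarProbability G)) *
            ∏ p ∈ Finset.univ \ B, w (plaquetteHolonomy U p.1 p.2.1.1 p.2.1.2)))⁻¹) U S = q S := by
  obtain ⟨-, hρq, -, hρm, hρpos⟩ := heatBath_cold_acceptMass_eq hL hw hm0 hm hM hw1 B t ht rank hrank π q hπ hq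
  have hw0 : ∀ g, 0 < w g := fun g => hm0.trans_le (hm g)
  have hc : 0 < ∫ g, w g ∂(haarProbability G) := haarProbability_integral_pos_of_continuous_pos hw hw0
  have hFRpos : ∀ V : GaugeConfig d L G, 0 < ∏ p ∈ Finset.univ \ B, w (plaquetteHolonomy V p.1 p.2.1.1 p.2.1.2) :=
    fun V => prod_pos fun p _ => hw0 _
  have hZB : (∫ V, ∏ p ∈ B, w (plaquetteHolonomy V p.1 p.2.1.1 p.2.1.2)
      ∂(Measure.pi fun _ : Edge d L => haarProbability G)) = (∫ g, w g ∂(haarProbability G)) ^ B.card :=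
    integral_prod_weight_eq_pow_of_rank (G := G) hL hw hm0 hm hM B t ht rank hrank
  have hZBpos : 0 < (∫ V, ∏ p ∈ B, w (plaquetteHolonomy V p.1 p.2.1.1 p.2.1.2)
      ∂(Measure.pi fun _ : Edge d L => haarProbability G)) := by
    rw [hZB]; exact pow_pos hc _
  have hZTpos : 0 < (∫ V, ∏ p : Plaquette d L, w (plaquetteHolonomy V p.1 p.2.1.1 p.2.1.2)
      ∂(Measure.pi fun _ : Edge d L => haarProbability G)) :=
    (div_pos_iff_of_pos_right (mul_pos hZBpos (hFRpos U))).1 (hρpos U)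
  set ρ : GaugeConfig d L G → ℝ := fun U => (∫ V, ∏ p : Plaquette d L, w (plaquetteHolonomy V p.1 p.2.1.1 p.2.1.2)
            ∂(Measure.pi fun _ : Edge d L => haarProbability G)) /
          ((∫ V, ∏ p ∈ B, w (plaquetteHolonomy V p.1 p.2.1.1 p.2.1.2)
            ∂(Measure.pi fun _ : Edge d L => haarProbability G)) *
            ∏ p ∈ Finset.univ \ B, w (plaquetteHolonomy U p.1 p.2.1.1 p.2.1.2)) with hρ
  have hwm : Measurable fun U => (ρ U)⁻¹ := hρm.inv
  have hw0' : ∀ U, 0 < (ρ U)⁻¹ := fun U => inv_pos.2 (hρpos U)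
  have hρpos' : ∀ V, 0 < ρ V := fun V => hρpos V
  have hπ' : (q.withDensity fun U => ENNReal.ofReal (ρ U)⁻¹) = π := withDensity_inv_density hρm hρpos hρq
  haveI : IsProbabilityMeasure (q.withDensity fun U => ENNReal.ofReal (ρ U)⁻¹) := by rw [hπ']; infer_instance
  -- the level sets of the kernel weight `ρ⁻¹ = Z_B F_R / Z` are the level sets of the uncovered weight `F_R`
  have hiff_le : ∀ V : GaugeConfig d L G, (ρ V)⁻¹ ≤ (ρ U)⁻¹ ↔ ∏ p ∈ Finset.univ \ B, w (plaquetteHolonomy V p.1 p.2.1.1 p.2.1.2) ≤ ∏ p ∈ Finset.univ \ B, w (plaquetteHolonomy U p.1 p.2.1.1 p.2.1.2) := by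
    intro V
    rw [inv_le_inv₀ (hρpos' V) (hρpos' U), hρ]
    show (∫ V, ∏ p : Plaquette d L, w (plaquetteHolonomy V p.1 p.2.1.1 p.2.1.2)
      ∂(Measure.pi fun _ : Edge d L => haarProbability G)) / ((∫ V, ∏ p ∈ B, w (plaquetteHolonomy V p.1 p.2.1.1 p.2.1.2)
      ∂(Measure.pi fun _ : Edge d L => haarProbability G)) * ∏ p ∈ Finset.univ \ B, w (plaquetteHolonomy U p.1 p.2.1.1 p.2.1.2)) ≤
      (∫ V, ∏ p : Plaquette d L, w (plaquetteHolonomy V p.1 p.2.1.1 p.2.1.2)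
      ∂(Measure.pi fun _ : Edge d L => haarProbability G)) / ((∫ V, ∏ p ∈ B, w (plaquetteHolonomy V p.1 p.2.1.1 p.2.1.2)
      ∂(Measure.pi fun _ : Edge d L => haarProbability G)) * ∏ p ∈ Finset.univ \ B, w (plaquetteHolonomy V p.1 p.2.1.1 p.2.1.2)) ↔ _
    rw [div_le_div_iff_of_pos_left hZTpos (mul_pos hZBpos (hFRpos U)) (mul_pos hZBpos (hFRpos V))]
    exact ⟨fun h => le_of_mul_le_mul_left h hZBpos, fun h => mul_le_mul_of_nonneg_left h hZBpos.le⟩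
  have hiff_lt : ∀ V : GaugeConfig d L G, (ρ U)⁻¹ < (ρ V)⁻¹ ↔ ∏ p ∈ Finset.univ \ B, w (plaquetteHolonomy U p.1 p.2.1.1 p.2.1.2) < ∏ p ∈ Finset.univ \ B, w (plaquetteHolonomy V p.1 p.2.1.1 p.2.1.2) := by
    intro V
    rw [← not_le, hiff_le V, not_le]
  have hlev_le : {V : GaugeConfig d L G | (ρ V)⁻¹ ≤ (ρ U)⁻¹} = {V | ∏ p ∈ Finset.univ \ B, w (plaquetteHolonomy V p.1 p.2.1.1 p.2.1.2) ≤ ∏ p ∈ Finset.univ \ B, w (plaquetteHolonomy U p.1 p.2.1.1 p.2.1.2)} :=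
    Set.ext fun V => hiff_le V
  have hlev_lt : {V : GaugeConfig d L G | (ρ U)⁻¹ < (ρ V)⁻¹} = {V | ∏ p ∈ Finset.univ \ B, w (plaquetteHolonomy U p.1 p.2.1.1 p.2.1.2) < ∏ p ∈ Finset.univ \ B, w (plaquetteHolonomy V p.1 p.2.1.1 p.2.1.2)} :=
    Set.ext fun V => hiff_lt V
  have hval : ((ρ U)⁻¹)⁻¹ = (∫ V, ∏ p : Plaquette d L, w (plaquetteHolonomy V p.1 p.2.1.1 p.2.1.2)
          ∂(Measure.pi fun _ : Edge d L => haarProbability G)) /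
        ((∫ g, w g ∂(haarProbability G)) ^ B.card * ∏ p ∈ Finset.univ \ B, w (plaquetteHolonomy U p.1 p.2.1.1 p.2.1.2)) := by
    rw [inv_inv, hρ]
    show (∫ V, ∏ p : Plaquette d L, w (plaquetteHolonomy V p.1 p.2.1.1 p.2.1.2)
      ∂(Measure.pi fun _ : Edge d L => haarProbability G)) / ((∫ V, ∏ p ∈ B, w (plaquetteHolonomy V p.1 p.2.1.1 p.2.1.2)
      ∂(Measure.pi fun _ : Edge d L => haarProbability G)) * ∏ p ∈ Finset.univ \ B, w (plaquetteHolonomy U p.1 p.2.1.1 p.2.1.2)) = _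
    rw [hZB]
  have hsub' : S ⊆ {V : GaugeConfig d L G | (ρ U)⁻¹ < (ρ V)⁻¹} := by rw [hlev_lt]; exact hsub
  exact indepMH_apply_of_subset_upper (q := q) hwm hw0' hS hsub'

/-- **INTO THE CONFIGURATIONS AT MOST AS ORDERED THE CHAIN MOVES AT THE TARGET'S RATE**:
`K(U, S) = (Z/(c^{#B}F_R(U)))·π(S)` for every measurable `S ⊆ {F_R ≤ F_R(U)}` with `U ∉ S`. [ours] -/
theorem heatBath_apply_of_less_ordered (hL : 2 ≤ L) {w : G → ℝ} (hw : Continuous w) {m M : ℝ} (hm0 : 0 < m)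
    (hm : ∀ g, m ≤ w g) (hM : ∀ g, w g ≤ M) (hw1 : w 1 = M)
    (B : Finset (Plaquette d L)) (t : Plaquette d L → Edge d L)
    (ht : ∀ p ∈ B, t p ∈ ({(p.1, p.2.1.1), (p.1.shift p.2.1.1, p.2.1.2),
        (p.1.shift p.2.1.2, p.2.1.1), (p.1, p.2.1.2)} : Finset (Edge d L)))
    (rank : Plaquette d L → ℕ)
    (hrank : ∀ p ∈ B, ∀ p' ∈ B, p ≠ p' → t p ∈ ({(p'.1, p'.2.1.1), (p'.1.shift p'.2.1.1, p'.2.1.2),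
        (p'.1.shift p'.2.1.2, p'.2.1.1), (p'.1, p'.2.1.2)} : Finset (Edge d L)) → rank p < rank p')
    (π q : Measure (GaugeConfig d L G)) [IsProbabilityMeasure π] [IsProbabilityMeasure q]
    (hπ : π = (Measure.pi fun _ : Edge d L => haarProbability G).withDensity fun U =>
      ENNReal.ofReal ((∏ p : Plaquette d L, w (plaquetteHolonomy U p.1 p.2.1.1 p.2.1.2)) /
        ∫ V, ∏ p : Plaquette d L, w (plaquetteHolonomy V p.1 p.2.1.1 p.2.1.2)
          ∂(Measure.pi fun _ : Edge d L => haarProbability G)))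
    (hq : q = (Measure.pi fun _ : Edge d L => haarProbability G).withDensity fun U =>
      ENNReal.ofReal ((∏ p ∈ B, w (plaquetteHolonomy U p.1 p.2.1.1 p.2.1.2)) /
        ∫ V, ∏ p ∈ B, w (plaquetteHolonomy V p.1 p.2.1.1 p.2.1.2)
          ∂(Measure.pi fun _ : Edge d L => haarProbability G))) (U : GaugeConfig d L G)
    {S : Set (GaugeConfig d L G)} (hS : MeasurableSet S)
    (hsub : S ⊆ {V | ∏ p ∈ Finset.univ \ B, w (plaquetteHolonomy V p.1 p.2.1.1 p.2.1.2) ≤ ∏ p ∈ Finset.univ \ B, w (plaquetteHolonomy U p.1 p.2.1.1 p.2.1.2)}) (hU : U ∉ S) :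
    (indepMH q (fun U =>
        ((∫ V, ∏ p : Plaquette d L, w (plaquetteHolonomy V p.1 p.2.1.1 p.2.1.2)
            ∂(Measure.pi fun _ : Edge d L => haarProbability G)) /
          ((∫ V, ∏ p ∈ B, w (plaquetteHolonomy V p.1 p.2.1.1 p.2.1.2)
            ∂(Measure.pi fun _ : Edge d L => haarProbability G)) *
            ∏ p ∈ Finset.univ \ B, w (plaquetteHolonomy U p.1 p.2.1.1 p.2.1.2)))⁻¹) U).real S =
      (∫ V, ∏ p : Plaquette d L, w (plaquetteHolonomy V p.1 p.2.1.1 p.2.1.2)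
          ∂(Measure.pi fun _ : Edge d L => haarProbability G)) /
        ((∫ g, w g ∂(haarProbability G)) ^ B.card * ∏ p ∈ Finset.univ \ B, w (plaquetteHolonomy U p.1 p.2.1.1 p.2.1.2)) * π.real S := by
  obtain ⟨-, hρq, -, hρm, hρpos⟩ := heatBath_cold_acceptMass_eq hL hw hm0 hm hM hw1 B t ht rank hrank π q hπ hq
  have hw0 : ∀ g, 0 < w g := fun g => hm0.trans_le (hm g)
  have hc : 0 < ∫ g, w g ∂(haarProbability G) := haarProbability_integral_pos_of_continuous_pos hw hw0
  have hFRpos : ∀ V : GaugeConfig d L G, 0 < ∏ p ∈ Finset.univ \ B, w (plaquetteHolonomy V p.1 p.2.1.1 p.2.1.2) :=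
    fun V => prod_pos fun p _ => hw0 _
  have hZB : (∫ V, ∏ p ∈ B, w (plaquetteHolonomy V p.1 p.2.1.1 p.2.1.2)
      ∂(Measure.pi fun _ : Edge d L => haarProbability G)) = (∫ g, w g ∂(haarProbability G)) ^ B.card :=
    integral_prod_weight_eq_pow_of_rank (G := G) hL hw hm0 hm hM B t ht rank hrank
  have hZBpos : 0 < (∫ V, ∏ p ∈ B, w (plaquetteHolonomy V p.1 p.2.1.1 p.2.1.2)
      ∂(Measure.pi fun _ : Edge d L => haarProbability G)) := by
    rw [hZB]; exact pow_pos hc _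
  have hZTpos : 0 < (∫ V, ∏ p : Plaquette d L, w (plaquetteHolonomy V p.1 p.2.1.1 p.2.1.2)
      ∂(Measure.pi fun _ : Edge d L => haarProbability G)) :=
    (div_pos_iff_of_pos_right (mul_pos hZBpos (hFRpos U))).1 (hρpos U)
  set ρ : GaugeConfig d L G → ℝ := fun U => (∫ V, ∏ p : Plaquette d L, w (plaquetteHolonomy V p.1 p.2.1.1 p.2.1.2)
            ∂(Measure.pi fun _ : Edge d L => haarProbability G)) /
          ((∫ V, ∏ p ∈ B, w (plaquetteHolonomy V p.1 p.2.1.1 p.2.1.2)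
            ∂(Measure.pi fun _ : Edge d L => haarProbability G)) *
            ∏ p ∈ Finset.univ \ B, w (plaquetteHolonomy U p.1 p.2.1.1 p.2.1.2)) with hρ
  have hwm : Measurable fun U => (ρ U)⁻¹ := hρm.inv
  have hw0' : ∀ U, 0 < (ρ U)⁻¹ := fun U => inv_pos.2 (hρpos U)
  have hρpos' : ∀ V, 0 < ρ V := fun V => hρpos V
  have hπ' : (q.withDensity fun U => ENNReal.ofReal (ρ U)⁻¹) = π := withDensity_inv_density hρm hρpos hρq
  haveI : IsProbabilityMeasure (q.withDensity fun U => ENNReal.ofReal (ρ U)⁻¹) := by rw [hπ']; infer_instance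
  -- the level sets of the kernel weight `ρ⁻¹ = Z_B F_R / Z` are the level sets of the uncovered weight `F_R`
  have hiff_le : ∀ V : GaugeConfig d L G, (ρ V)⁻¹ ≤ (ρ U)⁻¹ ↔ ∏ p ∈ Finset.univ \ B, w (plaquetteHolonomy V p.1 p.2.1.1 p.2.1.2) ≤ ∏ p ∈ Finset.univ \ B, w (plaquetteHolonomy U p.1 p.2.1.1 p.2.1.2) := by
    intro V
    rw [inv_le_inv₀ (hρpos' V) (hρpos' U), hρ]
    show (∫ V, ∏ p : Plaquette d L, w (plaquetteHolonomy V p.1 p.2.1.1 p.2.1.2)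
      ∂(Measure.pi fun _ : Edge d L => haarProbability G)) / ((∫ V, ∏ p ∈ B, w (plaquetteHolonomy V p.1 p.2.1.1 p.2.1.2)
      ∂(Measure.pi fun _ : Edge d L => haarProbability G)) * ∏ p ∈ Finset.univ \ B, w (plaquetteHolonomy U p.1 p.2.1.1 p.2.1.2)) ≤
      (∫ V, ∏ p : Plaquette d L, w (plaquetteHolonomy V p.1 p.2.1.1 p.2.1.2)
      ∂(Measure.pi fun _ : Edge d L => haarProbability G)) / ((∫ V, ∏ p ∈ B, w (plaquetteHolonomy V p.1 p.2.1.1 p.2.1.2)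
      ∂(Measure.pi fun _ : Edge d L => haarProbability G)) * ∏ p ∈ Finset.univ \ B, w (plaquetteHolonomy V p.1 p.2.1.1 p.2.1.2)) ↔ _
    rw [div_le_div_iff_of_pos_left hZTpos (mul_pos hZBpos (hFRpos U)) (mul_pos hZBpos (hFRpos V))]
    exact ⟨fun h => le_of_mul_le_mul_left h hZBpos, fun h => mul_le_mul_of_nonneg_left h hZBpos.le⟩
  have hiff_lt : ∀ V : GaugeConfig d L G, (ρ U)⁻¹ < (ρ V)⁻¹ ↔ ∏ p ∈ Finset.univ \ B, w (plaquetteHolonomy U p.1 p.2.1.1 p.2.1.2) < ∏ p ∈ Finset.univ \ B, w (plaquetteHolonomy V p.1 p.2.1.1 p.2.1.2) := by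
    intro V
    rw [← not_le, hiff_le V, not_le]
  have hlev_le : {V : GaugeConfig d L G | (ρ V)⁻¹ ≤ (ρ U)⁻¹} = {V | ∏ p ∈ Finset.univ \ B, w (plaquetteHolonomy V p.1 p.2.1.1 p.2.1.2) ≤ ∏ p ∈ Finset.univ \ B, w (plaquetteHolonomy U p.1 p.2.1.1 p.2.1.2)} :=
    Set.ext fun V => hiff_le V
  have hlev_lt : {V : GaugeConfig d L G | (ρ U)⁻¹ < (ρ V)⁻¹} = {V | ∏ p ∈ Finset.univ \ B, w (plaquetteHolonomy U p.1 p.2.1.1 p.2.1.2) < ∏ p ∈ Finset.univ \ B, w (plaquetteHolonomy V p.1 p.2.1.1 p.2.1.2)} :=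
    Set.ext fun V => hiff_lt V
  have hval : ((ρ U)⁻¹)⁻¹ = (∫ V, ∏ p : Plaquette d L, w (plaquetteHolonomy V p.1 p.2.1.1 p.2.1.2)
          ∂(Measure.pi fun _ : Edge d L => haarProbability G)) /
        ((∫ g, w g ∂(haarProbability G)) ^ B.card * ∏ p ∈ Finset.univ \ B, w (plaquetteHolonomy U p.1 p.2.1.1 p.2.1.2)) := by
    rw [inv_inv, hρ]
    show (∫ V, ∏ p : Plaquette d L, w (plaquetteHolonomy V p.1 p.2.1.1 p.2.1.2)
      ∂(Measure.pi fun _ : Edge d L => haarProbability G)) / ((∫ V, ∏ p ∈ B, w (plaquetteHolonomy V p.1 p.2.1.1 p.2.1.2)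
      ∂(Measure.pi fun _ : Edge d L => haarProbability G)) * ∏ p ∈ Finset.univ \ B, w (plaquetteHolonomy U p.1 p.2.1.1 p.2.1.2)) = _
    rw [hZB]
  have hsub' : S ⊆ {V : GaugeConfig d L G | (ρ V)⁻¹ ≤ (ρ U)⁻¹} := by rw [hlev_le]; exact hsub
  have h := indepMH_apply_of_subset_lower (q := q) hwm hw0' hS hsub' hU
  rw [hπ'] at h
  rw [Measure.real, h, ENNReal.toReal_mul, ← hval, ENNReal.toReal_ofReal (inv_nonneg.2 (hw0' U).le), Measure.real]

end Summit.Ventures.LatticeQCDFlow.Theory2.Autoregressive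

end
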